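import Literature.Probability.Distributions.PoissonBinomialChernoff
import HarnessLib

/-!
# Exponential tail of the level-`0` shell law of a typed ground set: the block count `2A + B` of a fully matched cut

For a `π`-stable ground set of `H`-type `(a, b, d)` (`a` edges inside the block `H`, `b` mixed, `d` outside) and `s` full edges,
the generating polynomial of the block count `X = |U ∩ H| = 2A + B` of a fully matched cut (`(A,B,D)` multivariate hypergeometric
`(s; a, b, d)`) is `P_{a,b,d,s}(X) = Σ_{α ≤ s} C(a,α)·X^{2α}·H_{b,d,s−α}(X)` (tree `ShellLawGeneratingPolynomial.shellGen_zero_eq_sum_hyperGen`;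
at level `c` the shell law is a mixture of shifts of these over half-sets, `shellGen_eq_sum_halfSets_hyperGen`). This file bounds its
UPPER TAIL beyond the centre `E = 2ᾱ + (s − ᾱ)·b/(b+d)`, `ᾱ = s·a/(a+b+d)`:

* §1 `hyperGen_upperTail_le_exp_param` — the parametrised Chernoff bound of `PoissonBinomialChernoff` §5 in `H_{b,d,r}` currency:
  `Σ_{k ≤ r, θ ≤ k} coeff_k(H_{b,d,r}) ≤ C(b+d,r)·exp((u+u²)μ − uθ)`, `μ = rb/(b+d)`, any `u ∈ [0,1]`, any real `θ`.
* §2 `coeff_levelZeroGen` (the coefficients of `P_{a,b,d,s}`), `sum_coeff_shift_le` (re-indexing a shifted tail).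
* §3 **`levelZeroGen_upperTail_le`** (THE BOUND): for `Λ ≥ 0` and `u, u′ ∈ [0,1]`,
  `Σ_{x ≤ 2s, E + Λ ≤ x} coeff_x(P_{a,b,d,s}) ≤ C(a+b+d, s)·( exp(u²·s − u·Λ/4) + exp(u′²·s − u′·Λ/2) )`
  — `X ≥ E + Λ` forces `α ≥ ᾱ + Λ/4` (Chernoff for the hypergeometric law of `α`, mass `C(a+b+d,s)` by Vandermonde =
  `eval_one_hyperGen`) or `K ≥ μ_K(α) + Λ/2` (`K ~ H_{b,d,s−α}`, since `X − E = (2 − β)(α − ᾱ) + (K − μ_K(α))`, `β = b/(b+d) ≤ 1`);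
  with `u = min(1, Λ/(8s))`, `u′ = min(1, Λ/(4s))` this is `≤ 2·C(a+b+d,s)·e^{−Λ²/(64 s)}` for `Λ ≤ 4s`.
* §4 (v2) **`levelZeroGen_lowerTail_le`** — the same bound for the LOWER tail `Σ_{x ≤ E − Λ} coeff_x` (`α ≤ ᾱ − Λ/4` or
  `K ≤ μ_K(α) − Λ/2`; `PoissonBinomialChernoff` §6).

Cell pnp-psdrank (prover g23, MEMO-26 §7 [TAIL]): summed over half-sets with the tree's mixture identity this is the tail input of
Theorems brick 121/122 (`ChebyshevTracialDesignVirtualPositivityCriterion` / `…CrossingPlaneConditional`). All PROVED, 0 sorry,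
no definitions, no named facts; finite sums over `ℝ`.

## References
* [Durrett2019] R. Durrett, *Probability: Theory and Examples*, 5th ed. (2019), §2.7 (exponential Markov / Chernoff bounds).
* [VatutinMikhailov1983] V. A. Vatutin, V. G. Mikhailov, Theory Probab. Appl. 27 (1983) 734–743, §2 (hypergeometric = Bernoulli sum).
* [Rothvoss2017] T. Rothvoß, J. ACM 64 (2017), §2 (PDF pp. 5–6): cuts, matchings, the three edge types.
-/

namespace Literature.Probability.Distributions

open Finset Polynomial
open Literature.Combinatorics.StablePolynomials (coeff_bernoulliProd_eq_pmf hyperGen coeff_hyperGen exists_bernoulliProd_eq_hyperGen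
  sum_eq_of_hyperGen_eq eval_one_hyperGen natDegree_hyperGen_le coeff_hyperGen_nonneg)

namespace PoissonBinomial

/-! ## §1 The parametrised Chernoff bound in hypergeometric currency -/

/-- **Parametrised Chernoff upper tail for `H_{b,d,r}`**: `Σ_{k ≤ r, θ ≤ k} coeff_k(H_{b,d,r}) ≤ C(b+d,r)·exp((u+u²)μ − uθ)` with
`μ = rb/(b+d)`, for every `u ∈ [0,1]` and real `θ`. [cite: VatutinMikhailov1983, §2] [cite: Durrett2019, §2.7] -/
theorem hyperGen_upperTail_le_exp_param {b d r : ℕ} (hr : r ≤ b + d) {u : ℝ} (hu0 : 0 ≤ u) (hu1 : u ≤ 1) (θ : ℝ) :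
    ∑ k ∈ (range (r + 1)).filter (fun k : ℕ => θ ≤ (k : ℝ)), (hyperGen b d r).coeff k ≤
      (((b + d).choose r : ℕ) : ℝ) * Real.exp ((u + u ^ 2) * ((r : ℝ) * b / ((b : ℝ) + d)) - u * θ) := by
  obtain ⟨ps, hps0, hlen, hG⟩ := exists_bernoulliProd_eq_hyperGen hr
  have hps : ∀ p ∈ ps, 0 ≤ p ∧ p ≤ 1 := fun p hp => ⟨(hps0 p hp).1.le, (hps0 p hp).2⟩
  have hmean : ps.sum = (r : ℝ) * b / ((b : ℝ) + d) := sum_eq_of_hyperGen_eq hr hlen hG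
  have hcoef : ∀ k, (hyperGen b d r).coeff k = (((b + d).choose r : ℕ) : ℝ) * pmf ps k := by
    intro k; rw [hG, coeff_C_mul, coeff_bernoulliProd_eq_pmf]
  rw [← hmean]
  have htail := upperTail_le_exp_param ps hps hu0 hu1 θ
  have hsum : ∑ k ∈ (range (r + 1)).filter (fun k : ℕ => θ ≤ (k : ℝ)), (hyperGen b d r).coeff k =
      (((b + d).choose r : ℕ) : ℝ) * ∑ k ∈ (range (ps.length + 1)).filter (fun k : ℕ => θ ≤ (k : ℝ)), pmf ps k := by
    rw [mul_sum, sum_congr rfl fun k _ => hcoef k]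
    symm
    refine sum_subset (fun k hk => ?_) (fun k hk hk' => ?_)
    · rw [mem_filter, mem_range] at hk ⊢; exact ⟨by omega, hk.2⟩
    · rw [mem_filter, mem_range] at hk hk'
      have hlt : ps.length < k := by
        by_contra h; exact hk' ⟨by omega, hk.2⟩
      rw [pmf_eq_zero_of_length_lt ps k hlt, mul_zero]
  rw [hsum]
  exact mul_le_mul_of_nonneg_left htail (by positivity)

/-- The full mass of `H_{b,d,r}` over any range beyond its degree: `Σ_{k ≤ m} coeff_k = C(b+d,r)` for `r ≤ m`.
[cite: VatutinMikhailov1983, §2] -/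
theorem sum_range_coeff_hyperGen (b d r : ℕ) {m : ℕ} (hm : r ≤ m) :
    ∑ k ∈ range (m + 1), (hyperGen b d r).coeff k = (((b + d).choose r : ℕ) : ℝ) := by
  have hdeg : (hyperGen b d r).natDegree < m + 1 := lt_of_le_of_lt (natDegree_hyperGen_le b d r) (by omega)
  rw [← eval_one_hyperGen b d r, eval_eq_sum_range' hdeg]
  simp

/-- If `r > b + d` every coefficient of `H_{b,d,r}` vanishes. [cite: VatutinMikhailov1983, §2] -/
theorem coeff_hyperGen_eq_zero_of_lt {b d r : ℕ} (h : b + d < r) (k : ℕ) : (hyperGen b d r).coeff k = 0 := by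
  rw [coeff_hyperGen]
  split_ifs with hk
  · by_cases hkb : b < k
    · rw [Nat.choose_eq_zero_of_lt hkb, zero_mul, Nat.cast_zero]
    · rw [Nat.choose_eq_zero_of_lt (show d < r - k by omega), mul_zero, Nat.cast_zero]
  · rfl

/-! ## §2 The level-`0` generating polynomial and its coefficients -/

/-- Coefficients of `P_{a,b,d,s} = Σ_α C(a,α)·X^{2α}·H_{b,d,s−α}`: `coeff_x = Σ_α C(a,α)·[2α ≤ x]·coeff_{x−2α}(H_{b,d,s−α})`.
[cite: Rothvoss2017, §2 (PDF p. 6)] -/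
theorem coeff_levelZeroGen (a b d s x : ℕ) :
    (∑ α ∈ range (s + 1), C ((a.choose α : ℕ) : ℝ) * X ^ (2 * α) * hyperGen b d (s - α)).coeff x =
      ∑ α ∈ range (s + 1), ((a.choose α : ℕ) : ℝ) * (if 2 * α ≤ x then (hyperGen b d (s - α)).coeff (x - 2 * α) else 0) := by
  rw [finsetSum_coeff]
  refine sum_congr rfl fun α _ => ?_
  rw [mul_assoc, coeff_C_mul, coeff_X_pow_mul']

/-- Re-indexing a shifted tail: for nonnegative coefficients, `Σ_{x ∈ F} [2α ≤ x]·q(x − 2α) ≤ Σ_{k ∈ G} q(k)` whenever every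
`x ∈ F` with `2α ≤ x` has `x − 2α ∈ G`. [cite: Durrett2019, §2.7] -/
theorem sum_shift_le {q : ℕ → ℝ} (hq : ∀ k, 0 ≤ q k) (α : ℕ) (F G : Finset ℕ)
    (hFG : ∀ x ∈ F, 2 * α ≤ x → x - 2 * α ∈ G) :
    ∑ x ∈ F, (if 2 * α ≤ x then q (x - 2 * α) else 0) ≤ ∑ k ∈ G, q k := by
  rw [← sum_filter]
  calc ∑ x ∈ F.filter (fun x => 2 * α ≤ x), q (x - 2 * α)
      = ∑ k ∈ (F.filter (fun x => 2 * α ≤ x)).image (fun x => x - 2 * α), q k := by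
        rw [sum_image]
        intro x hx y hy hxy
        have hx2 := (mem_filter.1 hx).2
        have hy2 := (mem_filter.1 hy).2
        simp only at hxy
        omega
    _ ≤ ∑ k ∈ G, q k := by
        refine sum_le_sum_of_subset_of_nonneg (fun k hk => ?_) (fun k _ _ => hq k)
        obtain ⟨x, hx, rfl⟩ := mem_image.1 hk
        exact hFG x (mem_filter.1 hx).1 (mem_filter.1 hx).2

/-! ## §3 The upper tail of the level-`0` law -/

/-- **EXPONENTIAL UPPER TAIL OF THE LEVEL-`0` SHELL LAW OF A TYPED GROUND SET.** With `N = a+b+d`, `s ≤ N`, `ᾱ = s·a/N`,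
`β = b/(b+d)`, centre `E = 2ᾱ + (s−ᾱ)β`, for every `Λ ≥ 0` and `u, u′ ∈ [0,1]`:
`Σ_{x ≤ 2s, E+Λ ≤ x} coeff_x(Σ_α C(a,α)X^{2α}H_{b,d,s−α}) ≤ C(N,s)·(exp(u²s − uΛ/4) + exp(u′²s − u′Λ/2))`.
Mechanism: `X − E = (2−β)(α − ᾱ) + (K − μ_K(α))`, so `X ≥ E + Λ` forces `α ≥ ᾱ + Λ/4` (tail of the hypergeometric `α`-law,
mass `C(N,s)`) or `K − μ_K(α) ≥ Λ/2` (tail of `H_{b,d,s−α}`); both by the parametrised Chernoff bound, `ᾱ, μ_K ≤ s`.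
[cite: Durrett2019, §2.7] [cite: VatutinMikhailov1983, §2] [cite: Rothvoss2017, §2 (PDF p. 6)] -/
theorem levelZeroGen_upperTail_le (a b d s : ℕ) (hs : s ≤ a + b + d) {Λ u u' : ℝ} (hΛ : 0 ≤ Λ)
    (hu0 : 0 ≤ u) (hu1 : u ≤ 1) (hu0' : 0 ≤ u') (hu1' : u' ≤ 1) :
    ∑ x ∈ (range (2 * s + 1)).filter (fun x : ℕ =>
        2 * ((s : ℝ) * a / ((a : ℝ) + b + d)) + ((s : ℝ) - (s : ℝ) * a / ((a : ℝ) + b + d)) * ((b : ℝ) / ((b : ℝ) + d)) + Λ ≤ (x : ℝ)),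
      (∑ α ∈ range (s + 1), C ((a.choose α : ℕ) : ℝ) * X ^ (2 * α) * hyperGen b d (s - α)).coeff x ≤
      (((a + b + d).choose s : ℕ) : ℝ) * (Real.exp (u ^ 2 * s - u * (Λ / 4)) + Real.exp (u' ^ 2 * s - u' * (Λ / 2))) := by
  set N : ℝ := (a : ℝ) + b + d with hN
  set abar : ℝ := (s : ℝ) * a / N with habar
  set β : ℝ := (b : ℝ) / ((b : ℝ) + d) with hβ
  set E : ℝ := 2 * abar + ((s : ℝ) - abar) * β with hE
  set F := (range (2 * s + 1)).filter (fun x : ℕ => E + Λ ≤ (x : ℝ)) with hF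
  -- basic ranges
  have hsR : (s : ℝ) ≤ N := by rw [hN]; exact_mod_cast hs
  have hN0 : 0 ≤ N := by rw [hN]; positivity
  have habar0 : 0 ≤ abar := by rw [habar]; positivity
  have habars : abar ≤ s := by
    rw [habar]
    rcases eq_or_lt_of_le hN0 with h0 | hpos
    · rw [← h0, div_zero]; positivity
    · rw [div_le_iff₀ hpos]
      have : (a : ℝ) ≤ N := by rw [hN]; linarith [(Nat.cast_nonneg b : (0:ℝ) ≤ b), (Nat.cast_nonneg d : (0:ℝ) ≤ d)]
      nlinarith
  have hβ0 : 0 ≤ β := by rw [hβ]; positivity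
  have hβ1 : β ≤ 1 := by
    rw [hβ]
    rcases eq_or_lt_of_le (by positivity : (0 : ℝ) ≤ (b : ℝ) + d) with h0 | hpos
    · rw [← h0, div_zero]; exact zero_le_one
    · rw [div_le_one hpos]; linarith [(Nat.cast_nonneg d : (0:ℝ) ≤ d)]
  -- expand the coefficients and swap the sums
  have hexp : ∑ x ∈ F, (∑ α ∈ range (s + 1), C ((a.choose α : ℕ) : ℝ) * X ^ (2 * α) * hyperGen b d (s - α)).coeff x =
      ∑ α ∈ range (s + 1), ((a.choose α : ℕ) : ℝ) *
        ∑ x ∈ F, (if 2 * α ≤ x then (hyperGen b d (s - α)).coeff (x - 2 * α) else 0) := by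
    rw [sum_congr rfl fun x _ => coeff_levelZeroGen a b d s x, sum_comm]
    refine sum_congr rfl fun α _ => by rw [mul_sum]
  rw [hexp]
  -- split `α` into GOOD (`α < ᾱ + Λ/4`) and BAD
  have hsplit : ∀ α ∈ range (s + 1), ((a.choose α : ℕ) : ℝ) *
      ∑ x ∈ F, (if 2 * α ≤ x then (hyperGen b d (s - α)).coeff (x - 2 * α) else 0) ≤
      ((a.choose α : ℕ) : ℝ) * ((((b + d).choose (s - α) : ℕ) : ℝ) * Real.exp (u' ^ 2 * s - u' * (Λ / 2))) +
      (if abar + Λ / 4 ≤ (α : ℝ) then ((a.choose α : ℕ) : ℝ) * (((b + d).choose (s - α) : ℕ) : ℝ) else 0) := by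
    intro α hα
    have hαs : α ≤ s := Nat.lt_succ_iff.1 (mem_range.1 hα)
    have hca : (0 : ℝ) ≤ ((a.choose α : ℕ) : ℝ) := by positivity
    have hq : ∀ k, 0 ≤ (hyperGen b d (s - α)).coeff k := fun k => coeff_hyperGen_nonneg b d (s - α) k
    by_cases hbad : abar + Λ / 4 ≤ (α : ℝ)
    · -- BAD α: bound the inner sum by the full mass `C(b+d, s−α)`
      rw [if_pos hbad]
      have hle : ∑ x ∈ F, (if 2 * α ≤ x then (hyperGen b d (s - α)).coeff (x - 2 * α) else 0) ≤
          (((b + d).choose (s - α) : ℕ) : ℝ) := by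
        rw [← sum_range_coeff_hyperGen b d (s - α) (show s - α ≤ 2 * s by omega)]
        refine sum_shift_le hq α F (range (2 * s + 1)) fun x hx h2 => ?_
        rw [mem_range]
        have hx2s : x < 2 * s + 1 := mem_range.1 (mem_filter.1 hx).1
        omega
      have h1 : ((a.choose α : ℕ) : ℝ) * ∑ x ∈ F, (if 2 * α ≤ x then (hyperGen b d (s - α)).coeff (x - 2 * α) else 0) ≤
          ((a.choose α : ℕ) : ℝ) * (((b + d).choose (s - α) : ℕ) : ℝ) := mul_le_mul_of_nonneg_left hle hca
      have h2 : 0 ≤ ((a.choose α : ℕ) : ℝ) * ((((b + d).choose (s - α) : ℕ) : ℝ) * Real.exp (u' ^ 2 * s - u' * (Λ / 2))) := by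
        positivity
      linarith
    · -- GOOD α: the shifted threshold is `≥ μ_K(α) + Λ/2`
      rw [if_neg hbad, add_zero]
      rw [not_le] at hbad
      refine mul_le_mul_of_nonneg_left ?_ hca
      set r := s - α with hr
      by_cases hrle : ¬ r ≤ b + d
      · -- degenerate: `H_{b,d,r} = 0` coefficientwise
        have hz : ∀ k, (hyperGen b d r).coeff k = 0 := coeff_hyperGen_eq_zero_of_lt (by omega)
        have : ∑ x ∈ F, (if 2 * α ≤ x then (hyperGen b d r).coeff (x - 2 * α) else 0) = 0 :=
          sum_eq_zero fun x _ => by split_ifs <;> simp [hz]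
        rw [this]; positivity
      rw [not_not] at hrle
      set μK : ℝ := (r : ℝ) * b / ((b : ℝ) + d) with hμK
      -- threshold bookkeeping: `E + Λ − 2α ≥ μ_K(α) + Λ/2`
      have hμKle : μK ≤ ((s : ℝ) - α) * β := by
        rw [hμK, hβ, hr, Nat.cast_sub hαs]; exact le_of_eq (by ring)
      have hthr : μK + Λ / 2 ≤ E + Λ - 2 * (α : ℝ) := by
        -- `E − 2α − (s−α)β = (2−β)(ᾱ−α) ≥ −(2−β)Λ/4 ≥ −Λ/2`
        have h1 : E - 2 * (α : ℝ) - ((s : ℝ) - α) * β = (2 - β) * (abar - α) := by rw [hE]; ring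
        have h2 : -(Λ / 2) ≤ (2 - β) * (abar - α) := by nlinarith
        linarith
      have hchern := hyperGen_upperTail_le_exp_param hrle hu0' hu1' (μK + Λ / 2)
      calc ∑ x ∈ F, (if 2 * α ≤ x then (hyperGen b d r).coeff (x - 2 * α) else 0)
          ≤ ∑ k ∈ (range (r + 1)).filter (fun k : ℕ => μK + Λ / 2 ≤ (k : ℝ)) ∪
              (Ico (r + 1) (2 * s + 1)), (hyperGen b d r).coeff k := by
            refine sum_shift_le hq α F _ fun x hx h2 => ?_
            have hxF := mem_filter.1 hx
            have hx2s : x < 2 * s + 1 := mem_range.1 hxF.1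
            rw [mem_union, mem_filter, mem_range, mem_Ico]
            by_cases hxr : x - 2 * α ≤ r
            · left
              refine ⟨by omega, ?_⟩
              have : ((x - 2 * α : ℕ) : ℝ) = (x : ℝ) - 2 * (α : ℝ) := by
                rw [Nat.cast_sub h2]; push_cast; ring
              rw [this]; linarith [hxF.2]
            · right; constructor <;> omega
        _ = ∑ k ∈ (range (r + 1)).filter (fun k : ℕ => μK + Λ / 2 ≤ (k : ℝ)), (hyperGen b d r).coeff k := by
            rw [sum_union]
            · have hz : ∑ k ∈ Ico (r + 1) (2 * s + 1), (hyperGen b d r).coeff k = 0 :=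
                sum_eq_zero fun k hk => coeff_eq_zero_of_natDegree_lt
                  (lt_of_le_of_lt (natDegree_hyperGen_le b d r) (by have := (mem_Ico.1 hk).1; omega))
              rw [hz, add_zero]
            · rw [disjoint_left]
              intro k hk hk'
              have h1 := mem_range.1 (mem_filter.1 hk).1
              have h2 := (mem_Ico.1 hk').1
              omega
        _ ≤ (((b + d).choose r : ℕ) : ℝ) * Real.exp ((u' + u' ^ 2) * μK - u' * (μK + Λ / 2)) := hchern
        _ ≤ (((b + d).choose r : ℕ) : ℝ) * Real.exp (u' ^ 2 * s - u' * (Λ / 2)) := by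
            refine mul_le_mul_of_nonneg_left (Real.exp_le_exp.2 ?_) (by positivity)
            have hμK0 : 0 ≤ μK := by rw [hμK]; positivity
            have hμKs : μK ≤ s := by
              refine hμKle.trans ?_
              have : ((s : ℝ) - α) * β ≤ ((s : ℝ) - α) * 1 :=
                mul_le_mul_of_nonneg_left hβ1 (by rw [← Nat.cast_sub hαs]; positivity)
              have hα0 : (0 : ℝ) ≤ α := Nat.cast_nonneg _
              linarith
            nlinarith [sq_nonneg u']
  refine (sum_le_sum hsplit).trans ?_
  rw [sum_add_distrib]
  -- GOOD part: `Σ_α C(a,α)C(b+d,s−α)·e = C(N,s)·e` (Vandermonde via `eval_one_hyperGen`)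
  have hvand : ∑ α ∈ range (s + 1), ((a.choose α : ℕ) : ℝ) * (((b + d).choose (s - α) : ℕ) : ℝ) =
      (((a + b + d).choose s : ℕ) : ℝ) := by
    have h := sum_range_coeff_hyperGen a (b + d) s le_rfl
    rw [show a + (b + d) = a + b + d by ring] at h
    rw [← h]
    refine sum_congr rfl fun α hα => ?_
    rw [coeff_hyperGen, if_pos (Nat.lt_succ_iff.1 (mem_range.1 hα))]; push_cast; ring
  have hgood : ∑ α ∈ range (s + 1), ((a.choose α : ℕ) : ℝ) *
      ((((b + d).choose (s - α) : ℕ) : ℝ) * Real.exp (u' ^ 2 * s - u' * (Λ / 2))) =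
      (((a + b + d).choose s : ℕ) : ℝ) * Real.exp (u' ^ 2 * s - u' * (Λ / 2)) := by
    rw [← hvand, sum_mul]
    exact sum_congr rfl fun α _ => by ring
  -- BAD part: the tail of the `α`-law `H_{a, b+d, s}` beyond `ᾱ + Λ/4`
  have hbad : ∑ α ∈ range (s + 1), (if abar + Λ / 4 ≤ (α : ℝ) then ((a.choose α : ℕ) : ℝ) * (((b + d).choose (s - α) : ℕ) : ℝ) else 0) ≤
      (((a + b + d).choose s : ℕ) : ℝ) * Real.exp (u ^ 2 * s - u * (Λ / 4)) := by
    rw [← sum_filter]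
    have hs' : s ≤ a + (b + d) := by omega
    have hch := hyperGen_upperTail_le_exp_param hs' hu0 hu1 (abar + Λ / 4)
    have hrew : ∑ α ∈ (range (s + 1)).filter (fun α : ℕ => abar + Λ / 4 ≤ (α : ℝ)),
        ((a.choose α : ℕ) : ℝ) * (((b + d).choose (s - α) : ℕ) : ℝ) =
        ∑ α ∈ (range (s + 1)).filter (fun α : ℕ => abar + Λ / 4 ≤ (α : ℝ)), (hyperGen a (b + d) s).coeff α := by
      refine sum_congr rfl fun α hα => ?_
      rw [coeff_hyperGen, if_pos (Nat.lt_succ_iff.1 (mem_range.1 (mem_filter.1 hα).1))]; push_cast; ring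
    rw [hrew]
    refine hch.trans ?_
    rw [show a + (b + d) = a + b + d by ring]
    refine mul_le_mul_of_nonneg_left (Real.exp_le_exp.2 ?_) (by positivity)
    have hmean : (s : ℝ) * a / ((a : ℝ) + ((b + d : ℕ) : ℝ)) = abar := by rw [habar, hN]; push_cast; ring
    rw [hmean]
    nlinarith [sq_nonneg u]
  linarith [hgood, hbad]

/-! ## §4 The lower tail of the level-`0` law -/

/-- **EXPONENTIAL LOWER TAIL OF THE LEVEL-`0` SHELL LAW OF A TYPED GROUND SET**: with the notation of
`levelZeroGen_upperTail_le`, for every `Λ ≥ 0` and `u, u′ ∈ [0,1]`: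
`Σ_{x ≤ 2s, x ≤ E−Λ} coeff_x(Σ_α C(a,α)X^{2α}H_{b,d,s−α}) ≤ C(N,s)·(exp(u²s − uΛ/4) + exp(u′²s − u′Λ/2))`
(`X ≤ E − Λ` forces `α ≤ ᾱ − Λ/4` or `K ≤ μ_K(α) − Λ/2`). [cite: Durrett2019, §2.7] [cite: VatutinMikhailov1983, §2]
[cite: Rothvoss2017, §2 (PDF p. 6)] -/
theorem levelZeroGen_lowerTail_le (a b d s : ℕ) (hs : s ≤ a + b + d) {Λ u u' : ℝ} (hΛ : 0 ≤ Λ)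
    (hu0 : 0 ≤ u) (hu1 : u ≤ 1) (hu0' : 0 ≤ u') (hu1' : u' ≤ 1) :
    ∑ x ∈ (range (2 * s + 1)).filter (fun x : ℕ =>
        (x : ℝ) ≤ 2 * ((s : ℝ) * a / ((a : ℝ) + b + d)) + ((s : ℝ) - (s : ℝ) * a / ((a : ℝ) + b + d)) * ((b : ℝ) / ((b : ℝ) + d)) - Λ),
      (∑ α ∈ range (s + 1), C ((a.choose α : ℕ) : ℝ) * X ^ (2 * α) * hyperGen b d (s - α)).coeff x ≤
      (((a + b + d).choose s : ℕ) : ℝ) * (Real.exp (u ^ 2 * s - u * (Λ / 4)) + Real.exp (u' ^ 2 * s - u' * (Λ / 2))) := by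
  set N : ℝ := (a : ℝ) + b + d with hN
  set abar : ℝ := (s : ℝ) * a / N with habar
  set β : ℝ := (b : ℝ) / ((b : ℝ) + d) with hβ
  set E : ℝ := 2 * abar + ((s : ℝ) - abar) * β with hE
  set F := (range (2 * s + 1)).filter (fun x : ℕ => (x : ℝ) ≤ E - Λ) with hF
  have hsR : (s : ℝ) ≤ N := by rw [hN]; exact_mod_cast hs
  have hN0 : 0 ≤ N := by rw [hN]; positivity
  have habar0 : 0 ≤ abar := by rw [habar]; positivity
  have habars : abar ≤ s := by
    rw [habar]
    rcases eq_or_lt_of_le hN0 with h0 | hpos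
    · rw [← h0, div_zero]; positivity
    · rw [div_le_iff₀ hpos]
      have : (a : ℝ) ≤ N := by rw [hN]; linarith [(Nat.cast_nonneg b : (0:ℝ) ≤ b), (Nat.cast_nonneg d : (0:ℝ) ≤ d)]
      nlinarith
  have hβ0 : 0 ≤ β := by rw [hβ]; positivity
  have hβ1 : β ≤ 1 := by
    rw [hβ]
    rcases eq_or_lt_of_le (by positivity : (0 : ℝ) ≤ (b : ℝ) + d) with h0 | hpos
    · rw [← h0, div_zero]; exact zero_le_one
    · rw [div_le_one hpos]; linarith [(Nat.cast_nonneg d : (0:ℝ) ≤ d)]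
  have hexp : ∑ x ∈ F, (∑ α ∈ range (s + 1), C ((a.choose α : ℕ) : ℝ) * X ^ (2 * α) * hyperGen b d (s - α)).coeff x =
      ∑ α ∈ range (s + 1), ((a.choose α : ℕ) : ℝ) *
        ∑ x ∈ F, (if 2 * α ≤ x then (hyperGen b d (s - α)).coeff (x - 2 * α) else 0) := by
    rw [sum_congr rfl fun x _ => coeff_levelZeroGen a b d s x, sum_comm]
    refine sum_congr rfl fun α _ => by rw [mul_sum]
  rw [hexp]
  -- split `α` into GOOD (`α > ᾱ − Λ/4`) and BAD (`α ≤ ᾱ − Λ/4`)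
  have hsplit : ∀ α ∈ range (s + 1), ((a.choose α : ℕ) : ℝ) *
      ∑ x ∈ F, (if 2 * α ≤ x then (hyperGen b d (s - α)).coeff (x - 2 * α) else 0) ≤
      ((a.choose α : ℕ) : ℝ) * ((((b + d).choose (s - α) : ℕ) : ℝ) * Real.exp (u' ^ 2 * s - u' * (Λ / 2))) +
      (if (α : ℝ) ≤ abar - Λ / 4 then ((a.choose α : ℕ) : ℝ) * (((b + d).choose (s - α) : ℕ) : ℝ) else 0) := by
    intro α hα
    have hαs : α ≤ s := Nat.lt_succ_iff.1 (mem_range.1 hα)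
    have hca : (0 : ℝ) ≤ ((a.choose α : ℕ) : ℝ) := by positivity
    have hq : ∀ k, 0 ≤ (hyperGen b d (s - α)).coeff k := fun k => coeff_hyperGen_nonneg b d (s - α) k
    by_cases hbad : (α : ℝ) ≤ abar - Λ / 4
    · rw [if_pos hbad]
      have hle : ∑ x ∈ F, (if 2 * α ≤ x then (hyperGen b d (s - α)).coeff (x - 2 * α) else 0) ≤
          (((b + d).choose (s - α) : ℕ) : ℝ) := by
        rw [← sum_range_coeff_hyperGen b d (s - α) (show s - α ≤ 2 * s by omega)]
        refine sum_shift_le hq α F (range (2 * s + 1)) fun x hx h2 => ?_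
        rw [mem_range]
        have hx2s : x < 2 * s + 1 := mem_range.1 (mem_filter.1 hx).1
        omega
      have h1 : ((a.choose α : ℕ) : ℝ) * ∑ x ∈ F, (if 2 * α ≤ x then (hyperGen b d (s - α)).coeff (x - 2 * α) else 0) ≤
          ((a.choose α : ℕ) : ℝ) * (((b + d).choose (s - α) : ℕ) : ℝ) := mul_le_mul_of_nonneg_left hle hca
      have h2 : 0 ≤ ((a.choose α : ℕ) : ℝ) * ((((b + d).choose (s - α) : ℕ) : ℝ) * Real.exp (u' ^ 2 * s - u' * (Λ / 2))) := by
        positivity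
      linarith
    · rw [if_neg hbad, add_zero]
      rw [not_le] at hbad
      refine mul_le_mul_of_nonneg_left ?_ hca
      set r := s - α with hr
      by_cases hrle : ¬ r ≤ b + d
      · have hz : ∀ k, (hyperGen b d r).coeff k = 0 := coeff_hyperGen_eq_zero_of_lt (by omega)
        have : ∑ x ∈ F, (if 2 * α ≤ x then (hyperGen b d r).coeff (x - 2 * α) else 0) = 0 :=
          sum_eq_zero fun x _ => by split_ifs <;> simp [hz]
        rw [this]; positivity
      rw [not_not] at hrle
      set μK : ℝ := (r : ℝ) * b / ((b : ℝ) + d) with hμK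
      have hμKeq : μK = ((s : ℝ) - α) * β := by
        rw [hμK, hβ, hr, Nat.cast_sub hαs]; ring
      -- `E − Λ − 2α ≤ μ_K(α) − Λ/2` since `E − 2α − (s−α)β = (2−β)(ᾱ−α) < (2−β)Λ/4 ≤ Λ/2`
      have hthr : E - Λ - 2 * (α : ℝ) ≤ μK - Λ / 2 := by
        have h1 : E - 2 * (α : ℝ) - ((s : ℝ) - α) * β = (2 - β) * (abar - α) := by rw [hE]; ring
        have h2 : (2 - β) * (abar - α) ≤ Λ / 2 := by nlinarith
        linarith
      have hchern := hyperGen_lowerTail_le_exp_param hrle hu0' hu1' (μK - Λ / 2)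
      calc ∑ x ∈ F, (if 2 * α ≤ x then (hyperGen b d r).coeff (x - 2 * α) else 0)
          ≤ ∑ k ∈ (range (r + 1)).filter (fun k : ℕ => (k : ℝ) ≤ μK - Λ / 2) ∪
              (Ico (r + 1) (2 * s + 1)), (hyperGen b d r).coeff k := by
            refine sum_shift_le hq α F _ fun x hx h2 => ?_
            have hxF := mem_filter.1 hx
            have hx2s : x < 2 * s + 1 := mem_range.1 hxF.1
            rw [mem_union, mem_filter, mem_range, mem_Ico]
            by_cases hxr : x - 2 * α ≤ r
            · left
              refine ⟨by omega, ?_⟩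
              have : ((x - 2 * α : ℕ) : ℝ) = (x : ℝ) - 2 * (α : ℝ) := by
                rw [Nat.cast_sub h2]; push_cast; ring
              rw [this]; linarith [hxF.2]
            · right; constructor <;> omega
        _ = ∑ k ∈ (range (r + 1)).filter (fun k : ℕ => (k : ℝ) ≤ μK - Λ / 2), (hyperGen b d r).coeff k := by
            rw [sum_union]
            · have hz : ∑ k ∈ Ico (r + 1) (2 * s + 1), (hyperGen b d r).coeff k = 0 :=
                sum_eq_zero fun k hk => coeff_eq_zero_of_natDegree_lt
                  (lt_of_le_of_lt (natDegree_hyperGen_le b d r) (by have := (mem_Ico.1 hk).1; omega))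
              rw [hz, add_zero]
            · rw [disjoint_left]
              intro k hk hk'
              have h1 := mem_range.1 (mem_filter.1 hk).1
              have h2 := (mem_Ico.1 hk').1
              omega
        _ ≤ (((b + d).choose r : ℕ) : ℝ) * Real.exp ((u' ^ 2 - u') * μK + u' * (μK - Λ / 2)) := hchern
        _ ≤ (((b + d).choose r : ℕ) : ℝ) * Real.exp (u' ^ 2 * s - u' * (Λ / 2)) := by
            refine mul_le_mul_of_nonneg_left (Real.exp_le_exp.2 ?_) (by positivity)
            have hμK0 : 0 ≤ μK := by rw [hμK]; positivity
            have hμKs : μK ≤ s := by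
              rw [hμKeq]
              have : ((s : ℝ) - α) * β ≤ ((s : ℝ) - α) * 1 :=
                mul_le_mul_of_nonneg_left hβ1 (by rw [← Nat.cast_sub hαs]; positivity)
              have hα0 : (0 : ℝ) ≤ α := Nat.cast_nonneg _
              linarith
            nlinarith [sq_nonneg u']
  refine (sum_le_sum hsplit).trans ?_
  rw [sum_add_distrib]
  have hvand : ∑ α ∈ range (s + 1), ((a.choose α : ℕ) : ℝ) * (((b + d).choose (s - α) : ℕ) : ℝ) =
      (((a + b + d).choose s : ℕ) : ℝ) := by
    have h := sum_range_coeff_hyperGen a (b + d) s le_rfl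
    rw [show a + (b + d) = a + b + d by ring] at h
    rw [← h]
    refine sum_congr rfl fun α hα => ?_
    rw [coeff_hyperGen, if_pos (Nat.lt_succ_iff.1 (mem_range.1 hα))]; push_cast; ring
  have hgood : ∑ α ∈ range (s + 1), ((a.choose α : ℕ) : ℝ) *
      ((((b + d).choose (s - α) : ℕ) : ℝ) * Real.exp (u' ^ 2 * s - u' * (Λ / 2))) =
      (((a + b + d).choose s : ℕ) : ℝ) * Real.exp (u' ^ 2 * s - u' * (Λ / 2)) := by
    rw [← hvand, sum_mul]
    exact sum_congr rfl fun α _ => by ring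
  -- BAD part: the LOWER tail of the `α`-law `H_{a, b+d, s}` below `ᾱ − Λ/4`
  have hbad : ∑ α ∈ range (s + 1), (if (α : ℝ) ≤ abar - Λ / 4 then ((a.choose α : ℕ) : ℝ) * (((b + d).choose (s - α) : ℕ) : ℝ) else 0) ≤
      (((a + b + d).choose s : ℕ) : ℝ) * Real.exp (u ^ 2 * s - u * (Λ / 4)) := by
    rw [← sum_filter]
    have hs' : s ≤ a + (b + d) := by omega
    have hch := hyperGen_lowerTail_le_exp_param hs' hu0 hu1 (abar - Λ / 4)
    have hrew : ∑ α ∈ (range (s + 1)).filter (fun α : ℕ => (α : ℝ) ≤ abar - Λ / 4),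
        ((a.choose α : ℕ) : ℝ) * (((b + d).choose (s - α) : ℕ) : ℝ) =
        ∑ α ∈ (range (s + 1)).filter (fun α : ℕ => (α : ℝ) ≤ abar - Λ / 4), (hyperGen a (b + d) s).coeff α := by
      refine sum_congr rfl fun α hα => ?_
      rw [coeff_hyperGen, if_pos (Nat.lt_succ_iff.1 (mem_range.1 (mem_filter.1 hα).1))]; push_cast; ring
    rw [hrew]
    refine hch.trans ?_
    rw [show a + (b + d) = a + b + d by ring]
    refine mul_le_mul_of_nonneg_left (Real.exp_le_exp.2 ?_) (by positivity)
    have hmean : (s : ℝ) * a / ((a : ℝ) + ((b + d : ℕ) : ℝ)) = abar := by rw [habar, hN]; push_cast; ring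
    rw [hmean]
    nlinarith [sq_nonneg u]
  linarith [hgood, hbad]

end PoissonBinomial

end Literature.Probability.Distributions
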